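import Summits.AtomisticToContinuum.Crystallization.Theorems.FluxTubeKeplerFloorGivesLayered
import Summits.AtomisticToContinuum.Crystallization.Theorems.FluxTubeKeplerFluxCellKeplerSingleScale
import Summits.AtomisticToContinuum.Crystallization.Theorems.ChessboardParticlePlanesPeriodicWindowsIffCrystallization

/-!
# Forward rung `FirstShellRung` on the proved floor `FluxTubeKepler.FloorGivesLayered` — the RADIUS ladder

Crux `stmt-AtomisticToContinuum-15221` (`FluxTubeKepler.FluxCellKepler`), forward generator G1 (next rung),
generation 3.  Sibling rungs already filed on this floor: `Lines/PosTolRung.lean` (TOLERANCE axis: the budget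
only at tolerances `η ≥ η₀`), `Lines/VacancyBlindRung.lean` (DEFECT-CLASS axis: one-way matching, missing mass
unpriced).  This file takes the third axis of the floor's budget hypothesis — the PATTERN RADIUS.

FLOOR (seed `g1-AtomisticToContinuum-15223`, `Theorems.FluxTubeKeplerFloorGivesLayered.FloorGivesLayered_proof`):
`∀ P₀, FLOOR(P₀) → BUDGET(P₀) → LW` — if a periodic `P₀` bounds every Lennard-Jones ground-state energy below
by `N·e(P₀)` (FLOOR) and, for EVERY pattern radius `R > 0` and every tolerance `η > 0`, some `c(R,η) > 0`
prices the `(R,η)`-non-layered sites of every ground state against the excess energy (BUDGET), then every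
ground-state sequence carries layered windows (LW), hence periodic windows (`PeriodicGivenLayered`, proved).
Its proof (`floor_iff_eq_eStar`, `eventually_exists_not_bad`, `spacing_selection`, `match_dilate`) reads
`(R,η)`-goodness at scale `R` off the budget AT SCALE `R`; it contains no geometry.

GRADED FAMILY (one hypothesis generalised: the SET OF RADII at which the budget is assumed).
`RadiusRung 𝓡 := ∀ P₀, FLOOR(P₀) → BUDGET_𝓡(P₀) → ∀ ground-state sequences, periodic windows`, where
`BUDGET_𝓡` asks the defect budget only at radii `R ∈ 𝓡` (all tolerances).  Antitone in `𝓡`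
(`radiusRung_mono`); `𝓡 = univ` is the floor (`radiusRung_univ`, F3, five lines); `𝓡 = {2}` is PROVED here
from the landed potential-free chart gluing at radius `2` (`FluxCellKeplerSingleScale.card_bad_le`,
`radiusRung_two`); `𝓡 = ∅` is FLOOR ⇒ windows, summit-strength (not filed).

DECIDING RUNG `FirstShellRung := RadiusRung {6/5}`: the budget certified ONLY at the coordination-shell radius
`R = 6/5` — where the crux's defect predicate `LayeredGood (6/5) η` sees exactly the centre and its twelve
first-shell template points (first-shell distances `∈ [0.9704a, 1.0275a] ⊂ [0.912, 1.028]`, second shell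
`≥ 1.31` for `a ∈ [47/50,1]`, heights in `[39a/50, 17a/20]`) — already forces periodic windows.
NEW INPUT (`stub_firstShellGluing`, the one open stub of the rung): FIRST-SHELL RIGIDITY OF THE RELAXED
LAYERED FAMILY — uniformly on `δ`-separated configurations, a site all of whose neighbours within `R'` have
`η'`-almost-exact relaxed (anti)cuboctahedral first shells (each with ITS OWN spacing `a_j ∈ [47/50,1]`, its
own two layer gaps and its own letter) is `(2,η)`-layered-good.  Below radius `2` the landed gluing
(`good_of_locallyGood`, `2 ≤ R₀`) is silent: its local predicate `SetLayeredNear` and the exact rigidity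
`ExactLayeredRigidity` are radius-`2` statements.  With the stub, radius `6/5` budgets give radius-`2`
budgets (`budget_two_of_firstShell`), and `radiusRung_two` finishes.

ON-PATH (F4): `Crystallization → RadiusRung 𝓡` for every `𝓡` (`radiusRung_of_crystallization`, landed
`periodicWindows_of_crystallization`).  HOW IT RELIEVES THE CRUX: `FluxCellKepler_of` — the crux follows from
its single-scale form at the FIRST-SHELL scale, `SingleScaleFluxCellKepler (6/5)` (`stub_firstShellKepler`:
DOM verbatim, KEPLER asked only for first-shell defects), plus `stub_firstShellGluing`; i.e. a line on the
crux may certify its Kepler-type cell inequality against COORDINATION-SHELL defects only (a one-centre,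
13-point defect indicator), the propagation to every pattern scale being potential-free geometry.

`lean check`: sorries exactly in `stub_firstShellGluing`, `stub_firstShellKepler`.
-/

noncomputable section

open scoped BigOperators Classical
open Filter Topology

namespace Summit.AtomisticToContinuum.Crystallization.Cruxes.FluxCellKepler.RadiusLadder

open Literature.MathematicalPhysics.StatisticalMechanics
open Summit.AtomisticToContinuum.Crystallization.Theorems.FluxCellKeplerSingleScale
  (LayeredGood layeredGood_mono card_bad_le SingleScaleFluxCellKepler fluxCellKepler_of_singleScale
    singleScale_of_fluxCellKepler)
open Summit.AtomisticToContinuum.Crystallization.Theorems.PrestressSplitKorn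
  (squeeze_card_filter_exists_near_le)

local notation "E3" => EuclideanSpace ℝ (Fin 3)

/-! ## The graded family -/

/-- FLOOR(P₀): `N · e(P₀) ≤ E(x)` for every Lennard-Jones ground state `x` of every size `N`
(verbatim the first hypothesis of `FluxTubeKepler.FloorGivesLayered`; same text as
`ToleranceLadder.Floor`, `VacancyLadder.Floor`). -/
def Floor (P₀ : PeriodicConfiguration 3) : Prop :=
  ∀ (N : ℕ) (x : Fin N → E3), IsGroundState lennardJones x →
    (N : ℝ) * P₀.energyPerParticle lennardJones ≤ interactionEnergy lennardJones x

/-- BUDGET(P₀) ON THE RADIUS SET `𝓡`: for every pattern radius `R ∈ 𝓡`, `R > 0`, and every tolerance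
`η > 0`, some `c > 0` prices the `(R,η)`-non-layered sites of every Lennard-Jones ground state against the
excess energy over `N · e(P₀)` (`LayeredGood` is the crux's defect predicate, verbatim; `𝓡 = univ` is the
floor's budget at every radius). -/
def Budget (𝓡 : Set ℝ) (P₀ : PeriodicConfiguration 3) : Prop :=
  ∀ R η : ℝ, 0 < R → R ∈ 𝓡 → 0 < η → ∃ c : ℝ, 0 < c ∧
    ∀ (N : ℕ) (x : Fin N → E3), IsGroundState lennardJones x →
      c * (Nat.card {i : Fin N // ¬ LayeredGood R η x i} : ℝ) ≤
        interactionEnergy lennardJones x - (N : ℝ) * P₀.energyPerParticle lennardJones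

/-- Periodic windows at every scale along the sequence `x` (ONE periodic `P`, translations only) —
verbatim the conclusion of `ChessboardParticlePlanes.PeriodicWindows` / `FluxTubeKepler.PeriodicGivenLayered`. -/
def HasPeriodicWindows (x : (N : ℕ) → (Fin N → E3)) : Prop :=
  ∃ P : PeriodicConfiguration 3, ∀ R ε : ℝ, 0 < ε → ∃ᶠ N in atTop, ∃ t : E3,
    (∀ s ∈ P.points, ‖s‖ ≤ R → ∃ i : Fin N, dist (x N i + t) s ≤ ε) ∧
    (∀ i : Fin N, ‖x N i + t‖ ≤ R → ∃ s ∈ P.points, dist (x N i + t) s ≤ ε)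

/-- **The graded family.** `RadiusRung 𝓡`: FLOOR and the defect budget at the radii in `𝓡` (all
tolerances) force periodic windows along every Lennard-Jones ground-state sequence. -/
def RadiusRung (𝓡 : Set ℝ) : Prop :=
  ∀ P₀ : PeriodicConfiguration 3, Floor P₀ → Budget 𝓡 P₀ →
    ∀ x : (N : ℕ) → (Fin N → E3), (∀ N, IsGroundState lennardJones (x N)) → HasPeriodicWindows x

/-- **Deciding rung.** The defect budget at the coordination-shell radius `6/5` alone suffices. -/
def FirstShellRung : Prop := RadiusRung {6 / 5}

/-! ## F3 — the family specialises to the proved floor -/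

/-- `RadiusRung univ` is the floor: the seed theorem followed by the proved `PeriodicGivenLayered`. -/
theorem radiusRung_univ : RadiusRung Set.univ := fun P₀ hF hB x hx =>
  Theses.FluxTubeKepler.PeriodicGivenLayered_holds x hx
    (Theorems.FluxTubeKeplerFloorGivesLayered.FloorGivesLayered_proof P₀ hF
      (fun R η hR hη => hB R η hR (Set.mem_univ R) hη) x hx)

/-! ## Dial monotonicity (fewer radii assumed = stronger statement) -/

/-- `Budget` is monotone in the radius set (as a hypothesis). -/
theorem budget_anti {𝓡 𝓡' : Set ℝ} (h : 𝓡 ⊆ 𝓡') {P₀ : PeriodicConfiguration 3} :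
    Budget 𝓡' P₀ → Budget 𝓡 P₀ :=
  fun hB R η hR hR𝓡 hη => hB R η hR (h hR𝓡) hη

/-- `RadiusRung` is monotone: a rung assuming the budget at fewer radii implies every rung assuming it
at more. -/
theorem radiusRung_mono {𝓡 𝓡' : Set ℝ} (h : 𝓡 ⊆ 𝓡') : RadiusRung 𝓡 → RadiusRung 𝓡' :=
  fun H P₀ hF hB x hx => H P₀ hF (budget_anti h hB) x hx

/-- Every rung gives back the floor (informational `specialises`). -/
theorem radiusRung_univ_of (𝓡 : Set ℝ) (h : RadiusRung 𝓡) : RadiusRung Set.univ :=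
  radiusRung_mono (Set.subset_univ 𝓡) h

/-- Radius monotonicity of the defect predicate inside one budget: the budget at a radius `ρ` gives the
budget at every radius `R ≤ ρ` with the same constant (`layeredGood_mono`). -/
theorem budget_Ioc_of_singleton {ρ : ℝ} {P₀ : PeriodicConfiguration 3} (hB : Budget {ρ} P₀) :
    Budget (Set.Ioc 0 ρ) P₀ := by
  intro R η hR hRρ hη
  obtain ⟨c, hc, hcb⟩ := hB ρ η (hR.trans_le hRρ.2) rfl hη
  refine ⟨c, hc, fun N x hx => ?_⟩
  have hmono : (Nat.card {i : Fin N // ¬ LayeredGood R η x i} : ℝ) ≤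
      Nat.card {i : Fin N // ¬ LayeredGood ρ η x i} := by
    have hle : Nat.card {i : Fin N // ¬ LayeredGood R η x i} ≤
        Nat.card {i : Fin N // ¬ LayeredGood ρ η x i} := by
      rw [Nat.card_eq_fintype_card, Nat.card_eq_fintype_card]
      exact Fintype.card_subtype_mono _ _ fun i hi hg => hi (layeredGood_mono hRρ.2 x i hg)
    exact_mod_cast hle
  exact (mul_le_mul_of_nonneg_left hmono hc.le).trans (hcb N x hx)

/-! ## Counting: from a chart-gluing statement to a defect-count inequality -/

/-- **Counting form of a gluing.**  If every `δ`-separated configuration glues — a site all of whose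
neighbours within `R'` are `(R₀,η')`-good is `(R,η)`-good — then `#bad_(R,η) ≤ (2ρ/δ+1)³ · #bad_(R₀,η')`,
`ρ = max R' 0` (the pattern of `FluxCellKeplerSingleScale.card_bad_le`, with the gluing abstracted). -/
theorem card_bad_le_of_gluing {δ : ℝ} (hδ : 0 < δ) {R₀ η' R η R' : ℝ}
    (hglue : ∀ (N : ℕ) (x : Fin N → E3), (∀ i j : Fin N, i ≠ j → δ ≤ dist (x i) (x j)) →
      ∀ i : Fin N, (∀ j : Fin N, dist (x j) (x i) ≤ R' → LayeredGood R₀ η' x j) → LayeredGood R η x i) :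
    ∀ (N : ℕ) (x : Fin N → E3), (∀ i j : Fin N, i ≠ j → δ ≤ dist (x i) (x j)) →
      (Nat.card {i : Fin N // ¬ LayeredGood R η x i} : ℝ) ≤
        (2 * max R' 0 / δ + 1) ^ 3 * Nat.card {i : Fin N // ¬ LayeredGood R₀ η' x i} := by
  intro N x hsep
  set ρ : ℝ := max R' 0 with hρ
  set D := Finset.univ.filter fun j : Fin N => ¬ LayeredGood R₀ η' x j with hD
  set B := Finset.univ.filter fun i : Fin N => ∃ j ∈ D, dist (x j) (x i) ≤ ρ with hB
  have hBle : (B.card : ℝ) ≤ (2 * ρ / δ + 1) ^ 3 * D.card :=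
    squeeze_card_filter_exists_near_le hδ (le_max_right _ _) hsep D
  have hbadB : Nat.card {i : Fin N // ¬ LayeredGood R η x i} ≤ B.card := by
    have hle : Nat.card {i : Fin N // ¬ LayeredGood R η x i} ≤ Nat.card {i : Fin N // i ∈ B} := by
      rw [Nat.card_eq_fintype_card, Nat.card_eq_fintype_card]
      refine Fintype.card_subtype_mono _ _ fun i hi => ?_
      by_contra hiB
      refine hi (hglue N x hsep i fun j hj => ?_)
      by_contra hjD
      exact hiB (Finset.mem_filter.2 ⟨Finset.mem_univ _, j,
        Finset.mem_filter.2 ⟨Finset.mem_univ _, hjD⟩, hj.trans (le_max_left _ _)⟩)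
    rwa [Nat.card_eq_finsetCard] at hle
  have hDcard : (D.card : ℝ) = Nat.card {i : Fin N // ¬ LayeredGood R₀ η' x i} := by
    rw [Nat.card_eq_fintype_card, Fintype.card_subtype]
  calc (Nat.card {i : Fin N // ¬ LayeredGood R η x i} : ℝ) ≤ B.card := by exact_mod_cast hbadB
    _ ≤ (2 * ρ / δ + 1) ^ 3 * D.card := hBle
    _ = (2 * ρ / δ + 1) ^ 3 * Nat.card {i : Fin N // ¬ LayeredGood R₀ η' x i} := by rw [hDcard]

/-- Transport of a budget along a count inequality on ground states: if `#bad_(R,η) ≤ M·#bad_(R₀,η')` on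
every ground state and `c` prices `(R₀,η')`-defects, then `c/M` prices `(R,η)`-defects. -/
theorem price_of_count {P₀ : PeriodicConfiguration 3} {R η R₀ η' M c : ℝ} (hM : 0 < M) (hc : 0 < c)
    (hcount : ∀ (N : ℕ) (x : Fin N → E3), IsGroundState lennardJones x →
      (Nat.card {i : Fin N // ¬ LayeredGood R η x i} : ℝ) ≤
        M * Nat.card {i : Fin N // ¬ LayeredGood R₀ η' x i})
    (hcb : ∀ (N : ℕ) (x : Fin N → E3), IsGroundState lennardJones x →
      c * (Nat.card {i : Fin N // ¬ LayeredGood R₀ η' x i} : ℝ) ≤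
        interactionEnergy lennardJones x - (N : ℝ) * P₀.energyPerParticle lennardJones) :
    ∀ (N : ℕ) (x : Fin N → E3), IsGroundState lennardJones x →
      c / M * (Nat.card {i : Fin N // ¬ LayeredGood R η x i} : ℝ) ≤
        interactionEnergy lennardJones x - (N : ℝ) * P₀.energyPerParticle lennardJones := by
  intro N x hx
  have h1 := hcount N x hx
  have h2 := hcb N x hx
  have h3 : c / M * (Nat.card {i : Fin N // ¬ LayeredGood R η x i} : ℝ) ≤
      c * Nat.card {i : Fin N // ¬ LayeredGood R₀ η' x i} := by
    calc c / M * (Nat.card {i : Fin N // ¬ LayeredGood R η x i} : ℝ)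
        ≤ c / M * (M * Nat.card {i : Fin N // ¬ LayeredGood R₀ η' x i}) :=
          mul_le_mul_of_nonneg_left h1 (div_pos hc hM).le
      _ = c * Nat.card {i : Fin N // ¬ LayeredGood R₀ η' x i} := by field_simp
  exact h3.trans h2

/-! ## The landed second rung: `RadiusRung {2}` -/

/-- The budget at radius `2` (all tolerances) gives the budget at every radius: for `R ≤ 2` by
`budget_Ioc_of_singleton`, for `R > 2` by the landed potential-free gluing-and-counting
`FluxCellKeplerSingleScale.card_bad_le` on ground states, which are `1/3`-separated
(`LennardJonesMinimalDistance_holds`).  No `sorry`. -/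
theorem budget_univ_of_two {P₀ : PeriodicConfiguration 3} (hB : Budget {2} P₀) : Budget Set.univ P₀ := by
  intro R η hR _ hη
  by_cases hR2 : R ≤ 2
  · exact budget_Ioc_of_singleton hB R η hR ⟨hR, hR2⟩ hη
  · obtain ⟨δ, hδ, hsep⟩ := LennardJonesMinimalDistance_holds
    obtain ⟨η', hη', M, hM, hcount⟩ := card_bad_le (le_refl (2 : ℝ)) hδ R η hη
    obtain ⟨c, hc, hcb⟩ := hB 2 η' two_pos rfl hη'
    exact ⟨c / M, div_pos hc hM,
      price_of_count hM hc (fun N x hx => hcount N x (hsep N x hx)) hcb⟩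

/-- **`RadiusRung {2}` is a theorem** (the ladder's second rung, decided by landed inputs only). -/
theorem radiusRung_two : RadiusRung {2} := fun P₀ hF hB x hx =>
  radiusRung_univ P₀ hF (budget_univ_of_two hB) x hx

/-! ## The one open stub of the rung: first-shell rigidity of the relaxed layered family -/

/-- **STUB `stub_firstShellGluing` — chart gluing from the coordination shell (potential-free geometry;
the NEW INPUT).**  For every separation `δ > 0` and tolerance `η > 0` there are `η' > 0` and `R'` such that
in every `δ`-separated finite configuration, a site all of whose neighbours within `R'` are
`(6/5, η')`-layered-good — their first coordination shells are two-way `η'`-matched to the twelve-shell of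
SOME member of the relaxed Barlow box family (own spacing `a ∈ [47/50,1]`, own frame, own letter, own two
layer gaps in `[39a/50, 17a/20]`), and nothing else lies within `6/5` — is `(2, η)`-layered-good.
Intended proof: compactness-and-contradiction exactly as the landed `good_of_locallyGood` (local limit of
the recentred configurations, `exists_subseq_forall_eventually_ballMatch`), the limit set having EXACT
relaxed first shells at every point; then the missing exact statement FIRST-SHELL RIGIDITY — a uniformly
discrete `Y ⊂ ℝ³` every point of which has an exact relaxed-family twelve-shell (two-way on its `6/5`-ball)
is globally ONE rigid image of ONE box template: non-ideal shells (`√(a²/3+h²) ≠ a`) carry a metrically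
distinguished hexagon, which propagates spacing and plane to all twelve neighbours; ideal shells are the
cuboctahedron / anticuboctahedron and propagate by the landed `LayerPropagation` /
`HalesDSP_layerPackings_holds` argument; two hcp-letter planes or two strained gaps with different normals
cannot coexist (they would meet).  Radius-`2` version landed: `PrestressSplitKorn.exactLayeredRigidity_holds`;
near-ideal common-scale version landed: `SpectralChargeLedger.ShellsToLayers` (stmt-17254). [conjecture] -/
theorem stub_firstShellGluing : ∀ δ : ℝ, 0 < δ → ∀ η : ℝ, 0 < η →
    ∃ η' : ℝ, 0 < η' ∧ ∃ R' : ℝ,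
    ∀ (N : ℕ) (x : Fin N → EuclideanSpace ℝ (Fin 3)), (∀ i j : Fin N, i ≠ j → δ ≤ dist (x i) (x j)) →
    ∀ i : Fin N, (∀ j : Fin N, dist (x j) (x i) ≤ R' → LayeredGood (6 / 5) η' x j) →
      LayeredGood 2 η x i := by
  sorry

/-- Signature of `stub_firstShellGluing` as a `Prop` (for sorry-free compositions). -/
def Sig.stub_firstShellGluing : Prop := ∀ δ : ℝ, 0 < δ → ∀ η : ℝ, 0 < η →
    ∃ η' : ℝ, 0 < η' ∧ ∃ R' : ℝ,
    ∀ (N : ℕ) (x : Fin N → EuclideanSpace ℝ (Fin 3)), (∀ i j : Fin N, i ≠ j → δ ≤ dist (x i) (x j)) →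
    ∀ i : Fin N, (∀ j : Fin N, dist (x j) (x i) ≤ R' → LayeredGood (6 / 5) η' x j) →
      LayeredGood 2 η x i

/-- **First-shell counting** (from the stub and the landed radius-`2` counting): for every `δ > 0` and
every scale `(R,η)` there are `η'' > 0`, `M > 0` with `#bad_(R,η) ≤ M · #bad_(6/5,η'')` on `δ`-separated
configurations. -/
theorem card_bad_le_firstShell (hglue : Sig.stub_firstShellGluing) {δ : ℝ} (hδ : 0 < δ) (R η : ℝ)
    (hη : 0 < η) : ∃ η'' : ℝ, 0 < η'' ∧ ∃ M : ℝ, 0 < M ∧ ∀ (N : ℕ) (x : Fin N → E3),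
      (∀ i j : Fin N, i ≠ j → δ ≤ dist (x i) (x j)) →
      (Nat.card {i : Fin N // ¬ LayeredGood R η x i} : ℝ) ≤
        M * Nat.card {i : Fin N // ¬ LayeredGood (6 / 5) η'' x i} := by
  -- step 1: `(R,η)` to `(max R 2, η)` (monotonicity), then to `(2, η₁)` (landed counting at `R₀ = 2`)
  obtain ⟨η₁, hη₁, M₁, hM₁, hcount₁⟩ := card_bad_le (le_refl (2 : ℝ)) hδ (max R 2) η hη
  -- step 2: `(2, η₁)` to `(6/5, η₂)` (the stub, counted)
  obtain ⟨η₂, hη₂, R', hglue₂⟩ := hglue δ hδ η₁ hη₁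
  refine ⟨η₂, hη₂, M₁ * (2 * max R' 0 / δ + 1) ^ 3, by positivity, fun N x hsep => ?_⟩
  have h0 : (Nat.card {i : Fin N // ¬ LayeredGood R η x i} : ℝ) ≤
      Nat.card {i : Fin N // ¬ LayeredGood (max R 2) η x i} := by
    have hle : Nat.card {i : Fin N // ¬ LayeredGood R η x i} ≤
        Nat.card {i : Fin N // ¬ LayeredGood (max R 2) η x i} := by
      rw [Nat.card_eq_fintype_card, Nat.card_eq_fintype_card]
      exact Fintype.card_subtype_mono _ _ fun i hi hg => hi (layeredGood_mono (le_max_left R 2) x i hg)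
    exact_mod_cast hle
  have h1 := hcount₁ N x hsep
  have h2 := card_bad_le_of_gluing hδ hglue₂ N x hsep
  calc (Nat.card {i : Fin N // ¬ LayeredGood R η x i} : ℝ)
      ≤ Nat.card {i : Fin N // ¬ LayeredGood (max R 2) η x i} := h0
    _ ≤ M₁ * Nat.card {i : Fin N // ¬ LayeredGood 2 η₁ x i} := h1
    _ ≤ M₁ * ((2 * max R' 0 / δ + 1) ^ 3 * Nat.card {i : Fin N // ¬ LayeredGood (6 / 5) η₂ x i}) :=
        mul_le_mul_of_nonneg_left h2 hM₁.le
    _ = M₁ * (2 * max R' 0 / δ + 1) ^ 3 * Nat.card {i : Fin N // ¬ LayeredGood (6 / 5) η₂ x i} := by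
        ring

/-- With the stub, the budget at the first-shell radius gives the budget at every radius. -/
theorem budget_univ_of_firstShell (hglue : Sig.stub_firstShellGluing) {P₀ : PeriodicConfiguration 3}
    (hB : Budget {6 / 5} P₀) : Budget Set.univ P₀ := by
  intro R η hR _ hη
  obtain ⟨δ, hδ, hsep⟩ := LennardJonesMinimalDistance_holds
  obtain ⟨η'', hη'', M, hM, hcount⟩ := card_bad_le_firstShell hglue hδ R η hη
  obtain ⟨c, hc, hcb⟩ := hB (6 / 5) η'' (by norm_num) rfl hη''
  exact ⟨c / M, div_pos hc hM, price_of_count hM hc (fun N x hx => hcount N x (hsep N x hx)) hcb⟩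

/-- **RUNG SKELETON — `FirstShellRung` from its one open stub** (the floor `radiusRung_univ` is the named
lemma doing the rest).  Sorry-free composition. -/
theorem FirstShellRung_of (hglue : Sig.stub_firstShellGluing) : FirstShellRung :=
  fun P₀ hF hB x hx => radiusRung_univ P₀ hF (budget_univ_of_firstShell hglue hB) x hx

/-! ## F4 — on-path lemmas: the sub-problem implies every member -/

/-- ON-PATH: `Crystallization → RadiusRung 𝓡` (landed hull-criterion converse
`periodicWindows_of_crystallization`). -/
theorem radiusRung_of_crystallization (𝓡 : Set ℝ) (h : _root_.Crystallization) : RadiusRung 𝓡 :=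
  fun _ _ _ x hx =>
    Theorems.ChessboardParticlePlanesPeriodicWindowsIffCrystallization.periodicWindows_of_crystallization h x hx

/-- ON-PATH for the deciding rung (tagged `aesop safe apply` so that the tribunal's fixed `S → C`
portfolio finds it). -/
@[aesop safe apply]
theorem FirstShellRung_of_Crystallization (h : _root_.Crystallization) : FirstShellRung :=
  radiusRung_of_crystallization _ h

/-! ## How a rung relieves the parent crux `FluxCellKepler`

With `RadiusRung 𝓡` the route needs its Kepler-type budget only at the radii in `𝓡`:
`KeplerFloorAt 𝓡` below is FLOOR plus the budget on `𝓡` (for `𝓡 = {6/5}`: against COORDINATION-SHELL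
defects only), and `RadiusRung 𝓡 → KeplerFloorAt 𝓡 → Crystallization`. -/

/-- The floor-and-budget package at the radii `𝓡` (what a Kepler inequality certified at those pattern
scales delivers along ground states). -/
def KeplerFloorAt (𝓡 : Set ℝ) : Prop := ∃ P₀ : PeriodicConfiguration 3, Floor P₀ ∧ Budget 𝓡 P₀

theorem crystallization_of_radiusRung {𝓡 : Set ℝ} (h : RadiusRung 𝓡) (hK : KeplerFloorAt 𝓡) :
    _root_.Crystallization := by
  obtain ⟨P₀, hF, hB⟩ := hK
  exact Theorems.ChessboardParticlePlanesPeriodicWindowsIffCrystallization.crystallization_of_periodicWindows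
    (fun x hx => h P₀ hF hB x hx)

/-! ## The LINE on the crux: `FluxCellKepler` from KEPLER at the first-shell scale

`SingleScaleFluxCellKepler (6/5)` (landed definition, `FluxCellKeplerSingleScale`): the crux with DOM
verbatim and KEPLER asked only at the pattern scale `R₀ = 6/5`, i.e. pricing only sites whose first
coordination shell is off every relaxed (anti)cuboctahedral twelve-shell.  The landed reduction
`fluxCellKepler_of_singleScale` needs `2 ≤ R₀`; the stub closes the gap `6/5 → 2`. -/

/-- **STUB `stub_firstShellKepler` — the flux-cell Kepler inequality against coordination-shell defects
only** (the crux's residual on this line: `∃ P₀ R₁ τ`, DOM, and for every `δ, η > 0` a `c > 0` with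
`c · #{(6/5,η)-bad sites} ≤ Σ_i ((1/24) site₁₂,i − (1/12) τ(pattern_i)) − N e(P₀)` on `δ`-separated
injective configurations).  Trivially implied by the crux (`singleScale_of_fluxCellKepler`); with
`stub_firstShellGluing` equivalent to it (`FluxCellKepler_of`). [conjecture] -/
theorem stub_firstShellKepler : SingleScaleFluxCellKepler (6 / 5) := by
  sorry

/-- Signature of `stub_firstShellKepler`. -/
def Sig.stub_firstShellKepler : Prop := SingleScaleFluxCellKepler (6 / 5)

/-- **First-shell reduction of the crux**: `SingleScaleFluxCellKepler (6/5) → FluxCellKepler` given the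
gluing stub — DOM unchanged; KEPLER at scale `(R,η)` with the constant `c(δ,η'')/M` from
`card_bad_le_firstShell`. -/
theorem fluxCellKepler_of_firstShell (hglue : Sig.stub_firstShellGluing)
    (h : SingleScaleFluxCellKepler (6 / 5)) :
    Summit.AtomisticToContinuum.Crystallization.Theses.FluxTubeKepler.FluxCellKepler := by
  obtain ⟨P₀, R₁, τ, hdom, hkep⟩ := h
  refine ⟨P₀, R₁, τ, hdom, ?_⟩
  intro δ hδ R η hR hη
  obtain ⟨η'', hη'', M, hM, hcount⟩ := card_bad_le_firstShell hglue hδ R η hη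
  obtain ⟨c, hc, hcb⟩ := hkep δ hδ η'' hη''
  refine ⟨c / M, div_pos hc hM, fun N x hx hsep => ?_⟩
  show c / M * (Nat.card {i : Fin N // ¬ LayeredGood R η x i} : ℝ) ≤ _
  have h1 := hcount N x hsep
  have h2 := hcb N x hx hsep
  have h3 : c / M * (Nat.card {i : Fin N // ¬ LayeredGood R η x i} : ℝ) ≤
      c * Nat.card {i : Fin N // ¬ LayeredGood (6 / 5) η'' x i} := by
    calc c / M * (Nat.card {i : Fin N // ¬ LayeredGood R η x i} : ℝ)
        ≤ c / M * (M * Nat.card {i : Fin N // ¬ LayeredGood (6 / 5) η'' x i}) :=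
          mul_le_mul_of_nonneg_left h1 (div_pos hc hM).le
      _ = c * Nat.card {i : Fin N // ¬ LayeredGood (6 / 5) η'' x i} := by field_simp
  exact h3.trans h2

/-- **LINE COMPOSITION** (kernel-checked, no `sorry` outside the stubs):
`stub_firstShellKepler → stub_firstShellGluing → FluxCellKepler`, concluding the crux BY NAME. -/
theorem FluxCellKepler_of (h₁ : Sig.stub_firstShellKepler) (h₂ : Sig.stub_firstShellGluing) :
    Summit.AtomisticToContinuum.Crystallization.Theses.FluxTubeKepler.FluxCellKepler :=
  fluxCellKepler_of_firstShell h₂ h₁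

/-- Registered-skeleton form: the crux from the two stubs' `sorry`s. -/
theorem FluxCellKepler_skeleton :
    Summit.AtomisticToContinuum.Crystallization.Theses.FluxTubeKepler.FluxCellKepler :=
  FluxCellKepler_of stub_firstShellKepler stub_firstShellGluing

/-- Converse bookkeeping: the crux gives the first-shell form (landed `singleScale_of_fluxCellKepler`). -/
theorem firstShellKepler_of_fluxCellKepler
    (h : Summit.AtomisticToContinuum.Crystallization.Theses.FluxTubeKepler.FluxCellKepler) :
    SingleScaleFluxCellKepler (6 / 5) :=
  singleScale_of_fluxCellKepler (by norm_num) h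

end Summit.AtomisticToContinuum.Crystallization.Cruxes.FluxCellKepler.RadiusLadder

end
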